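import Summits.AnomalousDissipation.AnomalousDissipation.Theorems.SolenoidalFractalHomogenisationLagrangianStepVmodFlatBlocks
import Summits.AnomalousDissipation.AnomalousDissipation.Theorems.SolenoidalFractalHomogenisationLagrangianStepFlatEnergyTracking
import Literature.Analysis.FluidPDE.PassiveVectorTensorPropagatorUnique
import Literature.Analysis.FluidPDE.DivFreeProjectionFourier
import HarnessLib

/-!
# K1L_D (stmt-AnomalousDissipation-27980): (V_mod) flat stage, input (F0) PROVED — drift-free constant-tensor propagators and their adjoints
# preserve Fourier supports (`VmodFlat.coarseSupp : VmodFlat.CoarseSupp_text`)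
(helper; `--supports 27980 --as helper`; prover ad-sawtooth-k1loc-p1 g14; line file `…VmodFlatBlocks` (p705511), memo K1loc-memo-v19 (ℓ2).)

The coarse member of the (V_mod) pair has no drift and a constant elliptic tensor, so every Fourier mode evolves on its own.  Forward map: a
propagator window map `U s t` sees only `P_σ x` (`apply_eq_apply_starProjection`), the Leray projection is a contraction modewise
(`norm_mFourierCoeff_starProjection_le`), and on solenoidal data the one-mode energy is non-increasing at EVERY time
(`FlatWindow.norm_sq_fcoeff_carrierFree_window`, lead-k1l-onelevel-p1 g4) — so a vanishing mode stays vanishing.  Adjoint: `IsPropagator.adjoint_eq`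
identifies `(U s t)†` with the propagator of the reversed problem (zero drift again, transposed tensor, same ellipticity window), to which the
forward statement applies.  Nothing about the blocks, the stub, the crux or AD is proved here (rung F-D1.A0).
-/

set_option linter.dupNamespace false

noncomputable section

namespace Summit.AnomalousDissipation.AnomalousDissipation.Theorems.SolenoidalFractalHomogenisation.LagrangianStep.VmodFlat

open Literature.Analysis Literature.Analysis.FluidPDE Literature.Analysis.FunctionSpaces
open MeasureTheory Set Filter UnitAddTorus
open scoped ENNReal NNReal InnerProductSpace

/-- **Forward support preservation** for a propagator of a problem whose carrier vanishes identically (stated for any carrier term equal to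
zero pointwise, so that reversed zero carriers are covered): `𝓕x(k) = 0 ⇒ 𝓕(U s t x)(k) = 0`, `0 ≤ s ≤ t ≤ T₀`. [folklore] -/
theorem fc_propagator_eq_zero {T₀ : ℝ} {𝔹 : Torus.Visc4 (Fin 3)} {lo' hi' : ℝ} (h𝔹 : Torus.NearIso 𝔹 lo' hi') (hlo' : 0 < lo')
    {b : ℝ → VF} (hb : ∀ r y, b r y = 0) {U : ℝ → ℝ → (V2 →L[ℝ] V2)} (hU : Torus.IsPropagator T₀ b 𝔹 U)
    {s t : ℝ} (hs : 0 ≤ s) (hst : s ≤ t) (htT : t ≤ T₀) (x : V2) {k : Fin 3 → ℤ} (hk : fc x k = 0) :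
    fc (U s t x) k = 0 := by
  obtain rfl : b = fun (_ : ℝ) (_ : UnitAddTorus (Fin 3)) => (0 : EuclideanSpace ℝ (Fin 3)) := funext fun r => funext fun y => hb r y
  set P := (Torus.divFreeL2 (Fin 3)).starProjection with hP
  have hPx : fc (P x) k = 0 := by
    have h := Torus.norm_mFourierCoeff_starProjection_le x k
    have h0 : ‖fc (P x) k‖ ≤ 0 := by
      calc ‖fc (P x) k‖ ≤ ‖fc x k‖ := h
        _ = 0 := by rw [hk, norm_zero]
    exact norm_le_zero_iff.1 h0
  have hPdiv : Torus.IsWeaklyDivFree (⇑(P x) : VF) := (Torus.mem_divFreeL2_iff _).1 ((Torus.divFreeL2 (Fin 3)).starProjection_apply_mem x)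
  rw [hU.apply_eq_apply_starProjection s t x]
  rcases lt_or_eq_of_le (hst.trans htT) with hsT | hsT
  · -- `s < T₀`: one-mode energy monotonicity at every time
    have h := (FlatWindow.norm_sq_fcoeff_carrierFree_window h𝔹 hlo' hU hs hst htT hsT (P x) hPdiv k).2
    have h0 : ‖fc (U s t (P x)) k‖ ^ 2 ≤ 0 := by
      calc ‖fc (U s t (P x)) k‖ ^ 2 ≤ ‖fc (P x) k‖ ^ 2 := h
        _ = 0 := by rw [hPx, norm_zero]; ring
    exact norm_eq_zero.1 (pow_eq_zero_iff two_ne_zero |>.1 (le_antisymm h0 (sq_nonneg _)))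
  · -- `s = T₀`: then `t = s` and `U s s (P x) = P x`
    have hts : t = s := le_antisymm (hsT ▸ htT) hst
    rw [hts, hU.self_of_divFree s hs (le_of_eq hsT) (P x) hPdiv]
    exact hPx

/-- **(F0) PROVED**: drift-free constant-tensor propagators and their adjoints preserve Fourier supports. -/
theorem coarseSupp : CoarseSupp_text := by
  intro Tw 𝔹 lo' hi' hlo' h𝔹 T hT s t hs hst htT x k hk
  refine ⟨fc_propagator_eq_zero h𝔹 hlo' (fun _ _ => rfl) hT hs hst htT x hk, ?_⟩
  rcases hst.eq_or_lt with hEq | hLt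
  · -- `s = t`: `T s s` is the Leray projection, self-adjoint
    subst hEq
    have hsT : s ≤ Tw := htT
    set P := (Torus.divFreeL2 (Fin 3)).starProjection with hP
    have hTss : T s s = P := by
      refine ContinuousLinearMap.ext fun y => ?_
      rw [hT.apply_eq_apply_starProjection s s y]
      exact hT.self_of_divFree s hs hsT (P y) ((Torus.mem_divFreeL2_iff _).1 ((Torus.divFreeL2 (Fin 3)).starProjection_apply_mem y))
    have hadj : ContinuousLinearMap.adjoint (T s s) = T s s := by
      rw [hTss, hP]
      exact (isSelfAdjoint_starProjection (Torus.divFreeL2 (Fin 3))).adjoint_eq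
    rw [hadj]
    exact fc_propagator_eq_zero h𝔹 hlo' (fun _ _ => rfl) hT hs le_rfl hsT x hk
  · -- `s < t`: the adjoint is the propagator of the reversed (again drift-free) problem with the transposed tensor
    have hb : MemLp (Torus.stLift (fun (_ : ℝ) (_ : UnitAddTorus (Fin 3)) => (0 : EuclideanSpace ℝ (Fin 3)))) ∞
        (volume.restrict (Ioo 0 Tw ×ˢ (univ : Set (EuclideanSpace ℝ (Fin 3))))) := memLp_top_const 0
    have hbdiv : ∀ᵐ τ ∂(volume.restrict (Ioo (0:ℝ) Tw)),
        Torus.IsWeaklyDivFree ((fun (_ : ℝ) (_ : UnitAddTorus (Fin 3)) => (0 : EuclideanSpace ℝ (Fin 3))) τ) :=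
      ae_of_all _ fun τ θ hθ => by simp
    rw [hT.adjoint_eq h𝔹 hlo' hb hbdiv hs hLt htT]
    have hV := Torus.isPropagator_propagator ((Torus.nearIso_majorTranspose_iff 𝔹 lo' hi').2 h𝔹) hlo'
      (Torus.memLp_top_stLift_reversed_window hb hs htT) (Torus.ae_isWeaklyDivFree_reversed_window hbdiv hs htT)
    exact fc_propagator_eq_zero ((Torus.nearIso_majorTranspose_iff 𝔹 lo' hi').2 h𝔹) hlo' (fun r y => by simp) hV
      le_rfl (by linarith) le_rfl x hk

end Summit.AnomalousDissipation.AnomalousDissipation.Theorems.SolenoidalFractalHomogenisation.LagrangianStep.VmodFlat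

end
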